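import Literature.AlgebraicGeometry.Motives.PoincareUniversal.ResidualStatement
import Literature.AlgebraicGeometry.Motives.PoincareUniversal.GraphCondition
import Literature.AlgebraicGeometry.Motives.PoincareUniversal.SeesawSheafIffGraphCond
import Literature.AlgebraicGeometry.Motives.PoincareUniversal.GraphCondInjectivePoints
import Literature.AlgebraicGeometry.Motives.PoincareUniversal.DualNumberRigid
import Literature.AlgebraicGeometry.Motives.PoincareUniversal.ExistsThickeningLift
import Literature.AlgebraicGeometry.Motives.PoincareUniversal.AffineFiniteTypeToAll
import Literature.AlgebraicGeometry.Motives.PoincareUniversal.SeesawSubscheme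
import Literature.AlgebraicGeometry.Motives.DualNumberPoints
import Literature.AlgebraicGeometry.Morphisms.FormallyUnramifiedOfClosedPoints
import Literature.AlgebraicGeometry.Morphisms.ClosedImmersionOfUnramifiedInjective
import Literature.AlgebraicGeometry.Morphisms.ClosedImmersionIsoOfThickenings
import Literature.AlgebraicGeometry.Morphisms.StalkOfDualNumberRigid
import HarnessLib

/-!
# The universal property of the normalised Poincaré sheaf over an arbitrary base (Mumford, *Abelian Varieties*, §13)

For a complex abelian variety `A₀` with an ample divisor `Θ`, the dual `Â = A₀.dualOf Θ hΘ` carries the normalised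
Poincaré sheaf `𝒫` on `A₀ × Â`; the RESIDUAL `U_a3_residual_poincareUniversal` (★ `PoincareUniversal/ResidualStatement`)
says that `(Â, 𝒫)` represents rigidified line bundles which are fibrewise in `Pic⁰` over EVERY `ℂ`-scheme `T`:
`∃! g : T → Â` with `(1 × g)^*𝒫 ≅ ℒ`.  This file is the COMPOSITION of the M13 road (Mumford §13, proof of the
Theorem p. 125, in the «mono, not étale» form): over an affine finite-type base the seesaw graph
`Γ ↪ T × Â` (scheme-theoretic seesaw theorem [GW II, Thm. 24.66] ★ `stub_M13_1_seesawSubscheme_holds` for the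
seesaw sheaf + «rigidifications kill the twist» ★ `seesawSheaf_iff_graphCond`) is proper and formally unramified (first-order rigidity
★ `stub_M13_3d_dualNumber_rigid` + ★ `Morphisms.stalk_of_dualNumber_rigid`), injective on `ℂ`-points
(★ `graphCond_injective_points`), hence a closed immersion (★ `Morphisms.isClosedImmersion_left_of_isProper_of_…`),
through which every point-thickening factors (★ `stub_M13_3_exists_thickening_lift`), hence an isomorphism
(★ `Morphisms.isIso_of_isClosedImmersion_left_of_forall_isClosed_factor`); its inverse followed by `pr_Â` is the
unique classifying map (`residual_affineFiniteType_of_M13`).  Zariski locality + spreading out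
(★ `stub_M13_0_of_affineFiniteType_holds`) give the residual over every base (`U_a3_residual_of_M13`).

* `exists_seesawGraph`, `graphCond_lift_id_iff` — the graph and its functor of points;
* `residual_affineFiniteType_of_M13 : U_a3_residual_affineFiniteType`;
* **`U_a3_residual_of_M13 : U_a3_residual_poincareUniversal`**.

## References
* D. Mumford, *Abelian Varieties* (1970), §8 Thm. 1 (p. 77), §10 (p. 89), §13 (Thm. p. 125 and its proof, pp. 125–130). [MumfordAV1970]
* U. Görtz, T. Wedhorn, *Algebraic Geometry II* (2023), Thm. 24.66 (pp. 542–546). [GortzWedhorn2023]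
* J. S. Milne, *Abelian Varieties* (2008), I §8 (pp. 36–37). [MilneAV2008]
* R. Hartshorne, *Algebraic Geometry* (1977), II Prop. 5.9 (p. 116). [Hartshorne1977]
-/

noncomputable section

open CategoryTheory CategoryTheory.Limits AlgebraicGeometry MonoidalCategory CartesianMonoidalCategory
open scoped DualNumber

namespace Literature.AlgebraicGeometry.Motives.AbelianVariety

open Literature.AlgebraicGeometry.AbelianSchemes Literature.AlgebraicGeometry.AbelianVarieties
  Literature.AlgebraicGeometry.Modules

/-! ## §1 Two generic wrappers ((4M-i), (4M-iv) of the road) -/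

/-- **No non-constant `ℂ[ε]`-points in the closed fibres ⇒ the stalk conditions** of
★ `Morphisms.formallyUnramified_of_forall_isClosed_map_maximalIdeal` (★ `Morphisms.stalk_of_dualNumber_rigid`, whose
`specOver ℂ ℂ[ε]` is ★ `dualNumberOver` by `rfl`). [cite: GortzWedhorn2020, (6.4) Prop. 6.7 and Exercise 3.18] -/
theorem stalkConditions_of_dualNumber_rigid {Γ T : SchemeOver ℂ} (p : Γ ⟶ T)
    [LocallyOfFiniteType T.hom] [LocallyOfFiniteType p.left]
    (h : ∀ (γ : dualNumberOver ⟶ Γ) (t : 𝟙_ (SchemeOver ℂ) ⟶ T), γ ≫ p = toUnit _ ≫ t →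
      ∃ γ₀ : 𝟙_ (SchemeOver ℂ) ⟶ Γ, γ = toUnit _ ≫ γ₀)
    (x : Γ.left) (hx : IsClosed ({x} : Set Γ.left)) :
    Function.Surjective (IsLocalRing.ResidueField.map (p.left.stalkMap x).hom) ∧
      (IsLocalRing.maximalIdeal (T.left.presheaf.stalk (p.left.base x))).map (p.left.stalkMap x).hom =
        IsLocalRing.maximalIdeal (Γ.left.presheaf.stalk x) :=
  Morphisms.stalk_of_dualNumber_rigid p h x hx

/-- **A closed immersion through which all point-thickenings of closed points factor is an isomorphism**
(★ `Morphisms.isIso_of_isClosedImmersion_left_of_forall_isClosed_factor` read through `Over.comp_left` and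
★ `thickeningPtι_left`). [cite: Hartshorne1977, Ch. II, Prop. 5.9 (p. 116)] -/
theorem isIso_of_isClosedImmersion_of_forall_thickeningPt {Γ T : SchemeOver ℂ} (i : Γ ⟶ T)
    [IsClosedImmersion i.left] [LocallyOfFiniteType T.hom]
    (h : ∀ t : T.left, IsClosed ({t} : Set T.left) → ∀ n : ℕ,
      ∃ s : thickeningPt T t n ⟶ Γ, s ≫ i = thickeningPtι T t n) :
    IsIso i := by
  refine Morphisms.isIso_of_isClosedImmersion_left_of_forall_isClosed_factor i fun t ht n => ?_
  obtain ⟨s, hs⟩ := h t ht n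
  refine ⟨s.left, ?_⟩
  have hs' := congrArg (fun f => f.left) hs
  rw [Over.comp_left, thickeningPtι_left] at hs'
  exact hs'

/-! ## §2 Over an affine finite-type base: the seesaw graph is a closed immersion ONTO `T` -/

section Assembly

variable (A₀ : AbelianVariety ℂ) {Θ : CartierDivisor A₀.X.left} (hΘ : Θ.IsAmple)
  (P : (A₀.X ⊗ (A₀.dualOf Θ hΘ).X).left.Modules)
  (T' : SchemeOver ℂ) (ℒ : (AbelianSchemeOver.ofAbelianVariety A₀).RigidifiedLineBundle T'.hom)

/-- **The seesaw graph `Γ ↪ T × Â` with its functor of points** `Γ(S) = {u ; GraphCond u}` (★ `stub_M13_1_seesawSubscheme_holds` for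
the seesaw sheaf + ★ `seesawSheaf_iff_graphCond`). [cite: MumfordAV1970, §13 (proof of the Thm. p. 125)] -/
theorem exists_seesawGraph [LocallyOfFiniteType T'.hom] (hP1 : HasRank P 1)
    (hnorm : Nonempty ((Scheme.Modules.pullback (sliceZero A₀ (A₀.dualOf Θ hΘ)).left).obj P ≅
      unitModule (A₀.dualOf Θ hΘ).X.left)) :
    ∃ (Γ : SchemeOver ℂ) (i : Γ ⟶ T' ⊗ (A₀.dualOf Θ hΘ).X)
      (_ : IsClosedImmersion i.left),
      ∀ (S : SchemeOver ℂ) (u : S ⟶ T' ⊗ (A₀.dualOf Θ hΘ).X),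
        (∃ v : S ⟶ Γ, v ≫ i = u) ↔ GraphCond A₀ hΘ P T' ℒ u := by
  haveI : LocallyOfFiniteType
      (CartesianMonoidalCategory.fst T' (A₀.dualOf Θ hΘ).X).left :=
    inferInstanceAs (LocallyOfFiniteType (pullback.fst T'.hom (A₀.dualOf Θ hΘ).X.hom))
  haveI : LocallyOfFiniteType (T' ⊗ (A₀.dualOf Θ hΘ).X).hom := by
    rw [← Over.w (CartesianMonoidalCategory.fst T' (A₀.dualOf Θ hΘ).X)]
    infer_instance
  obtain ⟨Z, i, hi, hZ⟩ := stub_M13_1_seesawSubscheme_holds A₀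
    (T' ⊗ (A₀.dualOf Θ hΘ).X) (seesawSheaf A₀ hΘ P T' ℒ)
    (hasRank_seesawSheaf (A := A₀.X) (T := T') (B := (A₀.dualOf Θ hΘ).X)
      (M := ℒ.L) (P := P) ℒ.hasRank_one hP1)
  exact ⟨Z, i, hi, fun S u => (hZ S u).trans (seesawSheaf_iff_graphCond A₀ hΘ P T' ℒ hP1 hnorm S u)⟩

/-- **The graph condition at a section `(1, s)` IS the universal-property clause for `g = s`.**
[cite: MumfordAV1970, §13 (proof of the Thm. p. 125)] -/
theorem graphCond_lift_id_iff (s : T' ⟶ (A₀.dualOf Θ hΘ).X) :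
    GraphCond A₀ hΘ P T' ℒ (CartesianMonoidalCategory.lift (𝟙 _) s) ↔
      Nonempty ((Scheme.Modules.pullback ((AbelianSchemeOver.ofAbelianVariety A₀).baseChangeToProd
        (AbelianSchemeOver.ofAbelianVariety (A₀.dualOf Θ hΘ)) T'.hom s.left (Over.w s))).obj P ≅ ℒ.L) := by
  have hφ : (AbelianSchemeOver.ofAbelianVariety A₀).baseChangeToProd
        (AbelianSchemeOver.ofAbelianVariety (A₀.dualOf Θ hΘ)) T'.hom
        (CartesianMonoidalCategory.lift (𝟙 _) s ≫ CartesianMonoidalCategory.snd _ _).left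
        (Over.w (CartesianMonoidalCategory.lift (𝟙 _) s ≫ CartesianMonoidalCategory.snd _ _)) =
      (AbelianSchemeOver.ofAbelianVariety A₀).baseChangeToProd
        (AbelianSchemeOver.ofAbelianVariety (A₀.dualOf Θ hΘ)) T'.hom s.left (Over.w s) :=
    AbelianSchemeOver.baseChangeToProd_congr _ _ _ (by rw [CartesianMonoidalCategory.lift_snd]) _ _
  have e₁ := congrArg (fun φ => (Scheme.Modules.pullback φ).obj P) hφ
  have e₂ : (Scheme.Modules.pullback (restrictAlong A₀ hΘ T' (CartesianMonoidalCategory.lift (𝟙 _) s))).obj ℒ.L ≅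
      ℒ.L :=
    eqToIso (congrArg (fun φ => (Scheme.Modules.pullback φ).obj ℒ.L) (restrictAlong_lift_id A₀ hΘ T' s)) ≪≫
      (Scheme.Modules.pullbackId _).app ℒ.L
  exact ⟨fun ⟨φ⟩ => ⟨(eqToIso e₁).symm ≪≫ φ ≪≫ e₂⟩, fun ⟨ψ⟩ => ⟨eqToIso e₁ ≪≫ ψ ≪≫ e₂.symm⟩⟩

/-- **ROAD M13 OVER AN AFFINE FINITE-TYPE BASE** (assembly (M13-5)): the seesaw graph
`Γ ↪ T × Â → T` is proper (★ `Â` proper) and formally unramified ((3d) + (4M-i)), injective on `ℂ`-points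
((M13-2/S4)) hence a monomorphism (★ `isIso_diagonal_of_injective_map`), hence a CLOSED IMMERSION (Mathlib
`IsClosedImmersion.iff_isProper_and_mono`), through which every point-thickening factors ((M13-3 ∃)), hence an
ISOMORPHISM ((4M-iv)); its inverse followed by `pr_Â` is the unique classifying map.
[cite: MumfordAV1970, §13 (Thm. p. 125 and its proof)] -/
theorem residual_affineFiniteType_of_M13 :
    U_a3_residual_affineFiniteType := by
  intro A₀ Θ hΘ P _ hP1 eP hnorm T f _ _ ℒ hℒ
  -- the base as a `ℂ`-scheme, `Â`, and their instances
  let T' : SchemeOver ℂ := Over.mk f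
  let B : SchemeOver ℂ := (A₀.dualOf Θ hΘ).X
  haveI : LocallyOfFiniteType T'.hom := ‹LocallyOfFiniteType f›
  haveI : IsAffine T'.left := ‹IsAffine T›
  obtain ⟨Γ, i, hi, hΓ⟩ := exists_seesawGraph A₀ hΘ P T' ℒ hP1 hnorm
  -- instances along `p := i ≫ pr_T : Γ → T`
  haveI : IsProper (CartesianMonoidalCategory.fst T' B).left :=
    inferInstanceAs (IsProper (pullback.fst T'.hom B.hom))
  haveI : IsProper (i ≫ CartesianMonoidalCategory.fst T' B).left := by
    change IsProper (i.left ≫ (CartesianMonoidalCategory.fst T' B).left)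
    infer_instance
  haveI : LocallyOfFiniteType Γ.hom := by
    rw [← Over.w (i ≫ CartesianMonoidalCategory.fst T' B)]
    infer_instance
  haveI : Mono i := (Over.forget _).mono_of_mono_map (inferInstanceAs (Mono i.left))
  -- (3d) + (4M-i): formally unramified (★ criterion at closed points + the dual-number bridge)
  have hrig : ∀ (γ : dualNumberOver ⟶ Γ) (t : 𝟙_ (SchemeOver ℂ) ⟶ T'),
      γ ≫ (i ≫ CartesianMonoidalCategory.fst T' B) = toUnit _ ≫ t →
        ∃ γ₀ : 𝟙_ (SchemeOver ℂ) ⟶ Γ, γ = toUnit _ ≫ γ₀ := by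
    intro γ t hγ
    have hc : GraphCond A₀ hΘ P T' ℒ (γ ≫ i) := (hΓ _ _).mp ⟨γ, rfl⟩
    have hu : (γ ≫ i) ≫ CartesianMonoidalCategory.fst _ _ = toUnit _ ≫ t := by
      rw [Category.assoc]; exact hγ
    obtain ⟨y, hy⟩ := stub_M13_3d_dualNumber_rigid A₀ hΘ P T' ℒ hP1 eP hnorm hℒ (γ ≫ i) t hu hc
    have hγi : γ ≫ i = toUnit _ ≫ CartesianMonoidalCategory.lift t y := by
      apply CartesianMonoidalCategory.hom_ext
      · rw [hu, Category.assoc, CartesianMonoidalCategory.lift_fst]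
      · rw [hy, Category.assoc, CartesianMonoidalCategory.lift_snd]
    refine ⟨dualNumberPoint ≫ γ, ?_⟩
    rw [← cancel_mono i]
    simp only [Category.assoc]
    rw [hγi, ← Category.assoc dualNumberPoint (toUnit _), dualNumberPoint_toUnit, Category.id_comp]
  haveI : JacobsonSpace ↥Γ.left := LocallyOfFiniteType.jacobsonSpace Γ.hom
  haveI : LocallyOfFiniteType (i ≫ CartesianMonoidalCategory.fst T' B).left := inferInstance
  haveI : FormallyUnramified (i ≫ CartesianMonoidalCategory.fst T' B).left :=
    Morphisms.formallyUnramified_of_forall_isClosed_map_maximalIdeal _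
      (fun x hx => (stalkConditions_of_dualNumber_rigid _ hrig x hx).1)
      (fun x hx => (stalkConditions_of_dualNumber_rigid _ hrig x hx).2)
  -- (M13-2/S4): injective on `ℂ`-points, hence ((4M)(ii)(iii) ★) a closed immersion
  have hinj : Function.Injective (AlgPoints.map (L := ℂ) (i ≫ CartesianMonoidalCategory.fst T' B)) := by
    intro x x' hxx'
    rw [AlgPoints.map_apply, AlgPoints.map_apply] at hxx'
    have hx : GraphCond A₀ hΘ P T' ℒ (x ≫ i) := (hΓ _ _).mp ⟨x, rfl⟩
    have hx' : GraphCond A₀ hΘ P T' ℒ (x' ≫ i) := (hΓ _ _).mp ⟨x', rfl⟩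
    have ex : x ≫ i = CartesianMonoidalCategory.lift
        (x ≫ i ≫ CartesianMonoidalCategory.fst _ _) (x ≫ i ≫ CartesianMonoidalCategory.snd _ _) := by
      apply CartesianMonoidalCategory.hom_ext
      · rw [CartesianMonoidalCategory.lift_fst, Category.assoc]
      · rw [CartesianMonoidalCategory.lift_snd, Category.assoc]
    have ex' : x' ≫ i = CartesianMonoidalCategory.lift
        (x ≫ i ≫ CartesianMonoidalCategory.fst _ _) (x' ≫ i ≫ CartesianMonoidalCategory.snd _ _) := by
      apply CartesianMonoidalCategory.hom_ext
      · rw [CartesianMonoidalCategory.lift_fst, Category.assoc, ← hxx']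
      · rw [CartesianMonoidalCategory.lift_snd, Category.assoc]
    have hyy' := graphCond_injective_points A₀ hΘ P T' ℒ hP1 eP _ _ _ (ex ▸ hx) (ex' ▸ hx')
    rw [← cancel_mono i, ex, ex', hyy']
  haveI : IsClosedImmersion (i ≫ CartesianMonoidalCategory.fst T' B).left :=
    Morphisms.isClosedImmersion_left_of_isProper_of_formallyUnramified_of_injective_complexPoints _ hinj
  -- (M13-3 ∃) + (4M-iv): an isomorphism
  haveI : IsIso (i ≫ CartesianMonoidalCategory.fst T' B) := by
    refine isIso_of_isClosedImmersion_of_forall_thickeningPt _ fun t ht n => ?_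
    obtain ⟨g, hg⟩ := stub_M13_3_exists_thickening_lift A₀ hΘ P T' ℒ hP1 eP hnorm hℒ t ht n
    obtain ⟨v, hv⟩ := (hΓ _ _).mpr hg
    exact ⟨v, by rw [← Category.assoc, hv, CartesianMonoidalCategory.lift_fst]⟩
  -- the section and the conclusion
  obtain ⟨σ, hσ⟩ : ∃ σ : T' ⟶ B,
      σ = inv (i ≫ CartesianMonoidalCategory.fst T' B) ≫ i ≫ CartesianMonoidalCategory.snd _ _ := ⟨_, rfl⟩
  have hsec : inv (i ≫ CartesianMonoidalCategory.fst T' B) ≫ i = CartesianMonoidalCategory.lift (𝟙 _) σ := by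
    apply CartesianMonoidalCategory.hom_ext
    · rw [CartesianMonoidalCategory.lift_fst, Category.assoc, IsIso.inv_hom_id]
    · rw [CartesianMonoidalCategory.lift_snd, Category.assoc, hσ]
  have hcσ : GraphCond A₀ hΘ P T' ℒ (CartesianMonoidalCategory.lift (𝟙 _) σ) :=
    hsec ▸ (hΓ _ _).mp ⟨_, rfl⟩
  refine ⟨⟨σ.left, Over.w σ⟩, (graphCond_lift_id_iff A₀ hΘ P T' ℒ σ).mp hcσ, ?_⟩
  rintro ⟨g', hg'⟩ hψ
  obtain ⟨s', hs'⟩ : ∃ s' : T' ⟶ B, s'.left = g' := ⟨Over.homMk g' hg', rfl⟩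
  subst hs'
  have hc' : GraphCond A₀ hΘ P T' ℒ (CartesianMonoidalCategory.lift (𝟙 _) s') :=
    (graphCond_lift_id_iff A₀ hΘ P T' ℒ s').mpr hψ
  obtain ⟨v, hv⟩ := (hΓ _ _).mpr hc'
  have hvp : v ≫ (i ≫ CartesianMonoidalCategory.fst T' B) = 𝟙 _ := by
    rw [← Category.assoc, hv, CartesianMonoidalCategory.lift_fst]
  have hv' : v = inv (i ≫ CartesianMonoidalCategory.fst T' B) := by
    rw [← cancel_mono (i ≫ CartesianMonoidalCategory.fst T' B), hvp, IsIso.inv_hom_id]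
  have hs : s' = σ := by
    rw [← CartesianMonoidalCategory.lift_snd (𝟙 _) s', ← hv, hv', Category.assoc, hσ]
  exact Subtype.ext (congrArg (fun s => s.left) hs)

end Assembly

/-! ## §3 The residual over every base -/

/-- **THE UNIVERSAL PROPERTY OF `(Â, 𝒫)` OVER EVERY `ℂ`-SCHEME** — `U_a3_residual_poincareUniversal`: Zariski locality and
spreading out (★ `stub_M13_0_of_affineFiniteType_holds`) reduce to an affine finite-type base, settled by
`residual_affineFiniteType_of_M13`. [cite: MumfordAV1970, §13 (Thm. p. 125)] -/
theorem U_a3_residual_of_M13 : U_a3_residual_poincareUniversal :=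
  stub_M13_0_of_affineFiniteType_holds residual_affineFiniteType_of_M13

end Literature.AlgebraicGeometry.Motives.AbelianVariety

end
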